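import Summits.HodgeConjecture.HodgeConjecture.Theorems.RigidUnwindingUnwindingReductionRankLocallyConstant
import Literature.AlgebraicGeometry.HodgeTheory.RankOneSubLocalSystemFiniteMonodromy
import HarnessLib

/-!
# Crux `UnwindingReduction` (stmt-HodgeConjecture-14767) — stub S2 `stub_finiteMonodromyOfRankLeOne`, granted Deligne's Cor. 4.2.8 (iii)(b)

Route `RigidUnwinding`, crux #3 `Theses.RigidUnwinding.UnwindingReduction` (`KummerEndgame → RigidComparison`),
registered skeleton `Cruxes/UnwindingReduction/Lines/birth.lean`. Its stub S2 `stub_finiteMonodromyOfRankLeOne`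
(`FiniteMonodromyOfRankLeOne`, the `r ≤ 1` corner of Katz's algorithm handed to `KummerEndgame`) reads:

> for a smooth projective family `f : 𝒴 ⟶ U` over an open `U ↪ ℙ¹_ℂ` and a FLAT family of idempotents `e_t` on
> `Hᵏ(Y_t(ℂ); ℂ)` of rank `≤ 1`, every `α ∈ im e_s` has only finitely many flat continuations along loops at `s`.

The skeleton's card sizes it "M/L (needs … the VHS package)": the content is Hodge-theoretic (a rank-one
sub-local system of `Rᵏ f_* ℂ` is unitary with algebraic-integer character values all of whose conjugates
have modulus one — Kronecker), and the tree has no polarized-VHS / semisimplicity package for `Rᵏ f_* ℂ` on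
its real carriers. The printed theorem that carries exactly this content is Deligne, *Théorie de Hodge II*,
Cor. 4.2.8 (iii)(b) (with Prop. 4.2.5 (i), (iii) to place `Rᵏ f_* ℚ` of a proper smooth `f` in a category
satisfying (4.2.2)): for a complex sub-local system `W ⊂ Rᵏ f_* ℂ` of dimension `d`, a tensor power of `∧ᵈ W`
is a TRIVIAL local system; for `d = 1` the printed proof ends (p. 48) "`χ(γ)` est donc une racine `k`-ième de
l'unité, avec `k ≤ N`. On a donc `χ^{N!} = 1`" — the monodromy of `W` is finite. This file

* imports that printed fact, stated ON THE CARRIERS (rank-one case, orbit form) as the NAMED FACT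
  `HodgeTheory.deligne1971_rankOne_subLocalSystem_finiteMonodromy` (`Literature/…/RankOneSubLocalSystemFiniteMonodromy`);
* proves **`finiteMonodromyOfRankLeOne_of_deligne1971 : (that fact) → (body of FiniteMonodromyOfRankLeOne)`**,
  VERBATIM the registered signature of S2 behind the one named fact: the base `U ⊂ ℙ¹` is smooth,
  irreducible and quasi-projective (`Theorems.…_of_isOpenImmersion_projectiveLine`, stub F of `KummerEndgame`),
  the flat piece `L = im e` is stable under continuation (`Theorems.transportFun_mem_range_of_flat` and
  `isContinuationAlong_iff_transportFun_eq`: continuations are transports), its rank is constant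
  (`Theorems.rankLocallyConstant`, stub S1, landed), so either `im e = 0` everywhere (the orbit of `α` is `{0}`)
  or `im e` is a rank-one sub-local system of `Rᵏ f_* ℂ` and Deligne's corollary applies.

So S2 closes MODULO ONE CITED C-ROW (Hodge II 4.2.8 (iii)(b)); the lead of line `birth` may reshape
`stub_finiteMonodromyOfRankLeOne := deligne1971_rankOne_subLocalSystem_finiteMonodromy → FiniteMonodromyOfRankLeOne`
(the pattern of `LimitExtensionMid`'s F0/F1). No `sorry`; the only non-Mathlib input that is not a tree theorem
is that named fact.

References: [DeligneHodgeII1971] P. Deligne, Théorie de Hodge II, Publ. Math. IHÉS 40 (1971), Prop. 4.2.5,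
Thm. 4.2.6, Cor. 4.2.8 (iii)(b) (pp. 44–48); [VoisinHodgeI2002] C. Voisin, Hodge Theory and Complex Algebraic
Geometry I (2002), §9.2.1 (local systems and transport); [Katz1996] N. Katz, Rigid Local Systems (1996), 5.2.1.
-/

-- `Summit.<Summit>.<Problem>`: for the single-conjunct summit `HodgeConjecture` the duplicate component is mandated.
set_option linter.dupNamespace false

noncomputable section

open CategoryTheory AlgebraicGeometry Topology
open Literature.AlgebraicGeometry.Motives Literature.AlgebraicGeometry.HodgeTheory
open Literature.AlgebraicTopology.SingularHomology

namespace Summit.HodgeConjecture.HodgeConjecture.Theorems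

/-- **Stub S2 of crux `UnwindingReduction`, granted Deligne's Cor. 4.2.8 (iii)(b)** — the body of
`FiniteMonodromyOfRankLeOne` (`Cruxes/UnwindingReduction/Lines/birth.lean`) VERBATIM behind the named fact
`deligne1971_rankOne_subLocalSystem_finiteMonodromy`: for a smooth projective family `f : 𝒴 ⟶ U` over an open
`U ↪ ℙ¹_ℂ` and a flat family of idempotents `e_t` on `Hᵏ(Y_t(ℂ); ℂ)` of rank `≤ 1`, every `α ∈ im e_s` has
finitely many flat continuations along loops at `s`. Proof: `U` is smooth of relative dimension `1`,
irreducible and quasi-projective (open in `ℙ¹`); `im e` is stable under continuation (a continuation along `γ`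
is the transport `γ_*`, `isContinuationAlong_iff_transportFun_eq`, and `γ_*(im e_s) ⊆ im e_t` for flat `e`,
`transportFun_mem_range_of_flat`); the rank of `e` is constant (`rankLocallyConstant`, stub S1); if it is `0`
the orbit of `α` lies in `im e_s = 0`, a singleton; if it is `1`, `t ↦ im e_t` is a rank-one sub-local system
of `Rᵏ f_* ℂ` and Deligne's corollary concludes.
[cite: DeligneHodgeII1971, Cor. 4.2.8 (iii)(b)] [cite: VoisinHodgeI2002, §9.2.1] -/
theorem finiteMonodromyOfRankLeOne_of_deligne1971
    (hD : deligne1971_rankOne_subLocalSystem_finiteMonodromy) :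
    ∀ (U 𝒴 : SchemeOver ℂ) (j : U ⟶ projectiveSpace 1 ℂ) (f : 𝒴 ⟶ U) (d k : ℕ)
      (e : ∀ t : ComplexPoints U, complexBetti (fiberOver f t) k →ₗ[ℂ] complexBetti (fiberOver f t) k),
      AlgebraicGeometry.IsOpenImmersion j.left → IsSmoothProjectiveFamily f d →
      (∀ t, e t ∘ₗ e t = e t) →
      (∀ (s t : ComplexPoints U) (γ : Path s t) (α : complexBetti (fiberOver f s) k)
          (β : complexBetti (fiberOver f t) k),
          IsContinuationAlong γ α β → IsContinuationAlong γ (e s α) (e t β)) →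
      (∀ t, Module.finrank ℂ (LinearMap.range (e t)) ≤ 1) →
      ∀ (s : ComplexPoints U) (α : complexBetti (fiberOver f s) k), α ∈ LinearMap.range (e s) →
        Set.Finite {β : complexBetti (fiberOver f s) k | ∃ γ : Path s s, IsContinuationAlong γ α β} := by
  intro U 𝒴 j f d k e hj hf hidem hflat hrk s α hα
  -- the base `U ⊂ ℙ¹`: smooth of relative dimension `1`, irreducible, quasi-projective; `Rᵏ f_* ℂ` a local system
  haveI := hj
  haveI : Nonempty U.left := ⟨s.pt⟩
  haveI : SmoothOfRelativeDimension 1 U.hom :=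
    smoothOfRelativeDimension_one_of_isOpenImmersion_projectiveLine j
  haveI hUsm : AlgebraicGeometry.Smooth U.hom := SmoothOfRelativeDimension.smooth 1 U.hom
  haveI hUirr : IrreducibleSpace U.left := irreducibleSpace_of_isOpenImmersion_projectiveLine j
  have hUqp : IsQuasiProjectiveOver U := isQuasiProjectiveOver_of_isOpenImmersion_projectiveLine j
  have hU := isCohomologicallyLocallyTrivialOn_univ_of_isSmoothProjectiveFamily f 1 hf hUqp
  -- the flat piece `L = im e` is stable under continuation along every path
  have hstab : ∀ (a b : ComplexPoints U) (γ : Path a b) (x : complexBetti (fiberOver f a) k)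
      (y : complexBetti (fiberOver f b) k),
      x ∈ LinearMap.range (e a) → IsContinuationAlong γ x y → y ∈ LinearMap.range (e b) := by
    intro a b γ x y hx hγ
    rw [← (isContinuationAlong_iff_transportFun_eq f k hU γ x y).1 hγ]
    exact transportFun_mem_range_of_flat f k hU e hflat (a := ⟨a, Set.mem_univ a⟩)
      (b := ⟨b, Set.mem_univ b⟩) _ hx
  -- rank dichotomy at `s`
  rcases Nat.lt_or_ge (Module.finrank ℂ (LinearMap.range (e s))) 1 with h0 | h1
  · -- rank `0` at `s`: the orbit of `α` lies in `im e_s = 0`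
    haveI : Module.Finite ℂ (complexBetti (fiberOver f s) k) := finite_complexBetti (hf.isSmoothProjective s) k
    have hbot : LinearMap.range (e s) = ⊥ := Submodule.finrank_eq_zero.1 (by omega)
    refine (Set.finite_singleton (0 : complexBetti (fiberOver f s) k)).subset ?_
    rintro β ⟨γ, hγ⟩
    have hβ := hstab s s γ α β hα hγ
    rw [hbot, Submodule.mem_bot] at hβ
    exact hβ
  · -- rank `1` at `s`, hence everywhere (stub S1): `im e` is a rank-one sub-local system of `Rᵏ f_* ℂ`
    have hrk1 : ∀ t, Module.finrank ℂ (LinearMap.range (e t)) = 1 := fun t =>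
      le_antisymm (hrk t) ((rankLocallyConstant U 𝒴 j f d k e hj hf hidem hflat s t) ▸ h1)
    exact hD 𝒴 U f d hf hUqp hUsm hUirr k (fun t => LinearMap.range (e t)) hrk1 hstab s α hα

end Summit.HodgeConjecture.HodgeConjecture.Theorems

end
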